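import Mathlib
import HarnessLib
import Literature.MathematicalPhysics.KineticTheory.HardSphereEulerProofs

/-!
# Glue S5 ⟸ S5' for line `Sketch` of the crux `KineticCurrentsWindowLDUniform` (stmt-AtomisticToContinuum-14662)

`stub_windowTransfer_of_renyi` (registered glue stub): the window transfer S5 (`stub_windowTransfer`,
general continuous profiles) follows from the RÉNYI QUASI-INVARIANCE S5' (`stub_windowRenyi`, the line's
registered dynamical residual on the transfer side: order `p > 1`, rate `e^{pδ(N+1)}` uniformly over the
kinetic window) by Liouville transport of the density and Hölder in `ℝ≥0∞` with `q = p / (p - 1)`.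
S5' is research-level off equilibrium (isothermal profiles: free, `stub_windowTransfer_isothermal`).

Notes (worker w-transfer of the lead seat, 2026-08-16).

* EQUIVALENCE. `stub_windowTransfer` with exponent `q` is EQUIVALENT to `stub_windowRenyi` with the
  conjugate `p = q/(q-1)` (duality `L^q`–`L^p`: test the transfer inequality on
  `G = ((ψ∘Φ_{-r})/ψ)^{p-1}`), so no weaker dynamical residual can close S5 as registered.
* WHAT IS FREE. For `1 < p < θ_max/(θ_max-θ_min)` the Rényi integral is FINITE with the crude bound
  `e^{C(p,a,u₀,θ₀,σ) (N+1)}` for EVERY `r` (not only the window): energy conservation gives the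
  pointwise bounds `ψ(Φ_{-r} z) ≤ Z⁻¹ Cᴺ e^{-(1-η)E(z)/θ_max}` and, on the domain,
  `ψ(z) ≥ Z⁻¹ cᴺ e^{-(1+η)E(z)/θ_min}`, and the resulting Gaussian is Liouville-integrable iff
  `p(1-η)/θ_max > (p-1)(1+η)/θ_min`. Log-convexity of `p ↦ log ∫ (ψ∘Φ_{-r})^p ψ^{1-p}` (value `0`
  at `p = 1`) then gives `≤ δ(N+1)` only at a `δ`-DEPENDENT exponent `p = 1 + (δ/C)(p₁-1)`, which the
  registered quantifier order (`∃ q` before `∀ δ`) forbids.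
* WHAT IS MISSING (research-level): the `e^{o(N)}` rate at a FIXED `p > 1` uniformly over the kinetic
  window `r ≤ τ(N+1)^{-1/3}` — a large-deviation bound on the (velocity-weighted) window collision
  counts under the local Gibbs law (each collision moves `log ψ` by `O(ε_N ‖∇(u₀,θ₀)‖ (1+|v|²))`)
  plus the fibrewise Gaussian comparison for the free flight.
-/

noncomputable section

open MeasureTheory Set Filter
open scoped ENNReal Topology

namespace Summit.AtomisticToContinuum.HydrodynamicLimit.Theorems.KineticCurrentsWindowLDUniformSketch

open Literature.Analysis.FluidPDE (HardSphereFlow Config localMaxwellian canonicalDensity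
  canonicalPartition hardSphereDomain tensorPow liouville particleLaw_eq)
open Literature.MathematicalPhysics.KineticTheory (T3 V3 hsDiameter localGibbsLaw localGibbsMeasure
  localGibbsProfile measurable_canonicalDensity measurable_localGibbsProfile
  canonicalPartition_eq_posPartition posPartition_pos localMaxwellian_pos)


/-- The canonical density of the local Gibbs profile is positive on the hard-sphere domain
(`a, θ₀ > 0` continuous, `σ ≤ 1/2`). -/
private theorem canonicalDensity_pos_of_mem {σ : ℝ} {a θ₀ : T3 → ℝ} {u₀ : T3 → V3}
    (ha : Continuous a) (hθ : Continuous θ₀) (hu : Continuous u₀)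
    (ha0 : ∀ x, 0 < a x) (hθ0 : ∀ x, 0 < θ₀ x) (hσ2 : σ ≤ 1 / 2) {N : ℕ}
    {z : Config (N + 1) (Fin 3) T3}
    (hz : z ∈ hardSphereDomain (Literature.Analysis.FluidPDE.Torus.geometry (Fin 3)) (N + 1)
      (hsDiameter σ N)) :
    0 < canonicalDensity (Literature.Analysis.FluidPDE.Torus.geometry (Fin 3)) (hsDiameter σ N) (N + 1)
      (localGibbsProfile a u₀ θ₀) z := by
  unfold canonicalDensity
  rw [Set.indicator_of_mem hz, canonicalPartition_eq_posPartition ha hθ hu (fun x => (ha0 x).le) hθ0]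
  refine mul_pos (inv_pos.2 (posPartition_pos ha ha0 hσ2 N)) ?_
  exact Finset.prod_pos fun i _ => mul_pos (ha0 _) (localMaxwellian_pos one_pos (hθ0 _) _ _)

/-- HÖLDER GLUE at fixed `N`, `r`: Liouville transport of the density plus Hölder in `ℝ≥0∞`. -/
private theorem transfer_of_renyi_fixed {σ : ℝ} {a θ₀ : T3 → ℝ} {u₀ : T3 → V3}
    (ha : Continuous a) (hθ : Continuous θ₀) (hu : Continuous u₀)
    (ha0 : ∀ x, 0 < a x) (hθ0 : ∀ x, 0 < θ₀ x) (hσ2 : σ ≤ 1 / 2) {N : ℕ}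
    (Φ : HardSphereFlow (Literature.Analysis.FluidPDE.Torus.geometry (Fin 3)) (hsDiameter σ N) (N + 1))
    {p q : ℝ} (hpq : p.HolderConjugate q) (r : ℝ) (B : ℝ≥0∞)
    (hR : ∫⁻ z, ENNReal.ofReal (canonicalDensity (Literature.Analysis.FluidPDE.Torus.geometry (Fin 3))
              (hsDiameter σ N) (N + 1) (localGibbsProfile a u₀ θ₀) (Φ.flow (-r) z)) ^ p *
            ENNReal.ofReal (canonicalDensity (Literature.Analysis.FluidPDE.Torus.geometry (Fin 3))
              (hsDiameter σ N) (N + 1) (localGibbsProfile a u₀ θ₀) z) ^ (1 - p)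
          ∂(liouville (Literature.Analysis.FluidPDE.Torus.geometry (Fin 3)) (N + 1) (hsDiameter σ N)) ≤ B)
    (G : Config (N + 1) (Fin 3) T3 → ℝ≥0∞) (hG : Measurable G) :
    ∫⁻ z, G (Φ.flow r z) ∂(localGibbsLaw σ a u₀ θ₀ N Φ) ≤
      B ^ (1 / p) * (∫⁻ z, G z ^ q ∂(localGibbsLaw σ a u₀ θ₀ N Φ)) ^ (1 / q) := by
  set L := liouville (Literature.Analysis.FluidPDE.Torus.geometry (Fin 3)) (N + 1) (hsDiameter σ N)
    with hL
  set ψ : Config (N + 1) (Fin 3) T3 → ℝ≥0∞ := fun z => ENNReal.ofReal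
    (canonicalDensity (Literature.Analysis.FluidPDE.Torus.geometry (Fin 3)) (hsDiameter σ N) (N + 1)
      (localGibbsProfile a u₀ θ₀) z) with hψ
  have hlaw : localGibbsLaw σ a u₀ θ₀ N Φ = L.withDensity ψ := by
    simp only [localGibbsLaw, particleLaw_eq, hL, hψ]
  have hψm : Measurable ψ :=
    (measurable_canonicalDensity (hsDiameter σ N) (N + 1)
      (measurable_localGibbsProfile ha hθ hu)).ennreal_ofReal
  have hψ0 : ∀ z ∈ Φ.good, ψ z ≠ 0 := fun z hz =>
    (ENNReal.ofReal_pos.2 (canonicalDensity_pos_of_mem ha hθ hu ha0 hθ0 hσ2 (Φ.good_subset hz))).ne'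
  have hψt : ∀ z, ψ z ≠ ⊤ := fun z => ENNReal.ofReal_ne_top
  -- Step 1: densities.
  have hGr : Measurable fun z => G (Φ.flow r z) := hG.comp (Φ.measurable_flow r)
  have hGq : Measurable fun z => G z ^ q := hG.pow_const q
  rw [hlaw, lintegral_withDensity_eq_lintegral_mul _ hψm hGr,
    lintegral_withDensity_eq_lintegral_mul _ hψm hGq]
  -- Step 2: Liouville transport `∫ ψ · G ∘ Φ_r dL = ∫ (ψ ∘ Φ_{-r}) · G dL`.
  have h2 : ∫⁻ z, (ψ * fun w => G (Φ.flow r w)) z ∂L = ∫⁻ z, ψ (Φ.flow (-r) z) * G z ∂L := by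
    have hae : (fun z => (ψ * fun w => G (Φ.flow r w)) z) =ᵐ[L]
        fun z => (fun w => ψ (Φ.flow (-r) w) * G w) (Φ.flow r z) := by
      filter_upwards [Φ.ae_mem_good] with z hz
      simp only [Pi.mul_apply, Φ.flow_neg_flow r hz]
    rw [lintegral_congr_ae hae]
    exact (Φ.measurePreserving r).lintegral_comp ((hψm.comp (Φ.measurable_flow (-r))).mul hG)
  rw [h2]
  -- Step 3: Hölder with `f = G ψ^{1/q}`, `g = (ψ ∘ Φ_{-r}) ψ^{-1/q}`.
  set f : Config (N + 1) (Fin 3) T3 → ℝ≥0∞ := fun z => G z * ψ z ^ (1 / q) with hf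
  set g : Config (N + 1) (Fin 3) T3 → ℝ≥0∞ := fun z => ψ (Φ.flow (-r) z) * (ψ z)⁻¹ ^ (1 / q)
    with hg
  have hfm : Measurable f := hG.mul (hψm.pow_const _)
  have hgm : Measurable g := (hψm.comp (Φ.measurable_flow (-r))).mul (hψm.inv.pow_const _)
  have h3 : ∫⁻ z, ψ (Φ.flow (-r) z) * G z ∂L = ∫⁻ z, (f * g) z ∂L := by
    refine lintegral_congr_ae ?_
    filter_upwards [Φ.ae_mem_good] with z hz
    simp only [hf, hg, Pi.mul_apply]
    calc ψ (Φ.flow (-r) z) * G z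
        = ψ (Φ.flow (-r) z) * G z * (ψ z * (ψ z)⁻¹) ^ (1 / q) := by
          rw [ENNReal.mul_inv_cancel (hψ0 z hz) (hψt z), ENNReal.one_rpow, mul_one]
      _ = G z * ψ z ^ (1 / q) * (ψ (Φ.flow (-r) z) * (ψ z)⁻¹ ^ (1 / q)) := by
          rw [ENNReal.mul_rpow_of_nonneg _ _ hpq.symm.one_div_nonneg]; ring
  rw [h3]
  refine (ENNReal.lintegral_mul_le_Lp_mul_Lq L hpq.symm hfm.aemeasurable hgm.aemeasurable).trans ?_
  -- Step 4: identify `∫ f^q = ∫ ψ G^q` and `∫ g^p = Rényi integral ≤ B`.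
  have hq0 : q ≠ 0 := hpq.symm.ne_zero
  have h4f : ∫⁻ z, f z ^ q ∂L = ∫⁻ z, (ψ * fun w => G w ^ q) z ∂L := by
    refine lintegral_congr fun z => ?_
    simp only [hf, Pi.mul_apply]
    rw [ENNReal.mul_rpow_of_nonneg _ _ hpq.symm.nonneg, ← ENNReal.rpow_mul,
      one_div_mul_cancel hq0, ENNReal.rpow_one, mul_comm]
  have h4g : ∫⁻ z, g z ^ p ∂L = ∫⁻ z, ψ (Φ.flow (-r) z) ^ p * ψ z ^ (1 - p) ∂L := by
    refine lintegral_congr fun z => ?_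
    simp only [hg]
    rw [ENNReal.mul_rpow_of_nonneg _ _ hpq.nonneg, ← ENNReal.rpow_mul, ENNReal.inv_rpow,
      ← ENNReal.rpow_neg]
    congr 2
    rw [one_div_mul_eq_div, hpq.div_conj_eq_sub_one]
    ring
  rw [h4f, h4g, mul_comm]
  exact mul_le_mul_left (ENNReal.rpow_le_rpow hR hpq.one_div_nonneg) _

/-- `(ofReal (exp (p x)))^{1/p} = ofReal (exp x)` for `p ≠ 0`. -/
private theorem ofReal_exp_mul_rpow_inv {p : ℝ} (hp : 0 < p) (x : ℝ) :
    ENNReal.ofReal (Real.exp (p * x)) ^ (1 / p) = ENNReal.ofReal (Real.exp x) := by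
  rw [ENNReal.ofReal_rpow_of_nonneg (Real.exp_pos _).le (one_div_pos.2 hp).le, ← Real.exp_mul,
    mul_comm p x, mul_assoc, mul_one_div_cancel hp.ne', mul_one]

/-- **Registered glue `stub_windowTransfer_of_renyi` (line `Sketch`, S5 ⟸ S5').** The window transfer S5 (single-time expectations of non-negative functionals at any time of a kinetic window are bounded by `e^{δ(N+1)}` times the `L^q(λ^N)`-norm at time `0`) follows from the RÉNYI QUASI-INVARIANCE of order `p > 1` of the local Gibbs law over the window, `∫ (ψ∘Φ_{-r})^p ψ^{1-p} dL ≤ e^{pδ(N+1)}` (`ψ` the canonical local Gibbs density, `L` the Liouville measure), with `q = p/(p-1)`: Liouville transport of the density, a.e. inversion on the good set, Hölder in `ℝ≥0∞`. By `L^p`–`L^q` duality the two statements are equivalent, so S5' is the exact dynamical residual of S5. [folklore] -/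
theorem stub_windowTransfer_of_renyi :
    (∀ (a θ₀ : T3 → ℝ) (u₀ : T3 → V3), Continuous a → Continuous θ₀ → Continuous u₀ →
      (∀ x, 0 < a x) → (∀ x, 0 < θ₀ x) → ∀ σ : ℝ, 0 < σ → σ ≤ 1 / 2 →
      ∃ p : ℝ, 1 < p ∧ ∀ τ : ℝ, 0 < τ → ∀ δ : ℝ, 0 < δ →
      ∀ Φ : (N : ℕ) →
        HardSphereFlow (Literature.Analysis.FluidPDE.Torus.geometry (Fin 3)) (hsDiameter σ N) (N + 1),
      ∃ N₀ : ℕ, ∀ N : ℕ, N₀ ≤ N → ∀ r ∈ Set.Icc (0 : ℝ) (τ * ((N : ℝ) + 1) ^ (-(1 / 3 : ℝ))),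
        ∫⁻ z, ENNReal.ofReal (canonicalDensity (Literature.Analysis.FluidPDE.Torus.geometry (Fin 3))
              (hsDiameter σ N) (N + 1) (localGibbsProfile a u₀ θ₀) ((Φ N).flow (-r) z)) ^ p *
            ENNReal.ofReal (canonicalDensity (Literature.Analysis.FluidPDE.Torus.geometry (Fin 3))
              (hsDiameter σ N) (N + 1) (localGibbsProfile a u₀ θ₀) z) ^ (1 - p)
          ∂(liouville (Literature.Analysis.FluidPDE.Torus.geometry (Fin 3)) (N + 1) (hsDiameter σ N)) ≤
        ENNReal.ofReal (Real.exp (p * (δ * ((N : ℝ) + 1))))) →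
    ∀ (a θ₀ : T3 → ℝ) (u₀ : T3 → V3), Continuous a → Continuous θ₀ → Continuous u₀ →
      (∀ x, 0 < a x) → (∀ x, 0 < θ₀ x) → ∀ σ : ℝ, 0 < σ → σ ≤ 1 / 2 →
      ∃ q : ℝ, 1 ≤ q ∧ ∀ τ : ℝ, 0 < τ → ∀ δ : ℝ, 0 < δ →
      ∀ Φ : (N : ℕ) →
        HardSphereFlow (Literature.Analysis.FluidPDE.Torus.geometry (Fin 3)) (hsDiameter σ N) (N + 1),
      ∃ N₀ : ℕ, ∀ N : ℕ, N₀ ≤ N → ∀ r ∈ Set.Icc (0 : ℝ) (τ * ((N : ℝ) + 1) ^ (-(1 / 3 : ℝ))),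
      ∀ G : Config (N + 1) (Fin 3) T3 → ℝ≥0∞, Measurable G →
        ∫⁻ z, G ((Φ N).flow r z) ∂(localGibbsLaw σ a u₀ θ₀ N (Φ N)) ≤
          ENNReal.ofReal (Real.exp (δ * ((N : ℝ) + 1))) *
            (∫⁻ z, G z ^ q ∂(localGibbsLaw σ a u₀ θ₀ N (Φ N))) ^ (1 / q) := by
  intro hRenyi a θ₀ u₀ ha hθ hu ha0 hθ0 σ hσ hσ2
  obtain ⟨p, hp1, hp⟩ := hRenyi a θ₀ u₀ ha hθ hu ha0 hθ0 σ hσ hσ2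
  have hpq : p.HolderConjugate (Real.conjExponent p) := Real.HolderConjugate.conjExponent hp1
  refine ⟨Real.conjExponent p, hpq.symm.lt.le, ?_⟩
  intro τ hτ δ hδ Φ
  obtain ⟨N₀, hN₀⟩ := hp τ hτ δ hδ Φ
  refine ⟨N₀, fun N hN r hr G hG => ?_⟩
  have h := transfer_of_renyi_fixed ha hθ hu ha0 hθ0 hσ2 (Φ N) hpq r _ (hN₀ N hN r hr) G hG
  rwa [ofReal_exp_mul_rpow_inv hpq.pos] at h

end Summit.AtomisticToContinuum.HydrodynamicLimit.Theorems.KineticCurrentsWindowLDUniformSketch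

end
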